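import Mathlib
import HarnessLib
import Summits.AtomisticToContinuum.FouriersLaw.Theses.JunctionLocality
import Summits.AtomisticToContinuum.FouriersLaw.Theorems.JunctionLocalitySuperadditiveResistanceDeviceLiouville
import Summits.AtomisticToContinuum.FouriersLaw.Theorems.JunctionLocalityConductanceLowerBoundRelocDirichlet
import Summits.AtomisticToContinuum.FouriersLaw.Theorems.JunctionLocalityConductanceLowerBoundStubRelocPositiveConductance

/-!
# Resolvent relocated conductances are strictly positive (stub `stub_relocPositiveConductance_resolvent`, R3λ,
of line `cold-bath-relocation-walk`, crux stmt-AtomisticToContinuum-11749 `JunctionLocality.ConductanceLowerBound`)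

Setting: ONE `L`-site pinned anharmonic chain `P = pinnedChain ω₂ lam β γ` (all parameters `> 0`), its Gibbs state
`μ_T = P.gibbsMeasure L T` (`T > 0`), and the RELOCATED equilibrium generator `L_m = X_H + γ (S_0 + S_m)` — hot
thermostat on site `0`, cold thermostat on site `m < L` (`m = 0` allowed: both baths on site `0`)
(`X_H = liouvilleOp P L`, `S_s = thermo L s T = T∂²_{p_s} − p_s∂_{p_s}`).  A RESOLVENT field is a classical
`u ∈ C² ∩ L²(μ_T)` with `λ u − L_m u = p_0² − T` pointwise, `λ > 0` (Lean name `l`).  For every such `u` the Kubo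
conductance functional `G[u] = γ (1 − (γ/T²) ∫ u (p_0² − T) dμ_T)` is STRICTLY POSITIVE
(`stub_relocPositiveConductance_resolvent`) — the walk of the line divides by it at every cold-bath position.

Proof (every input landed; nothing taken as a named fact).  Write `s = ∫ u (p_0² − T) dμ_T`, `N = ∫ u² dμ_T`,
`A_i = ∫ (∂_{p_i} u)² dμ_T`, `J = ∫ ∂_{p_0} u · p_0 dμ_T`.
* PAIR FORM (`relocResolvent_pair`): `X_H u + γ S_{B_m} u = −k` with weights `B_m = 𝟙_0 + 𝟙_m` and SOURCE
  `k = (p_0² − T) − λ u ∈ L²(μ_T)`.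
* WEIGHTED DIRICHLET IDENTITY (landed `integral_mul_source_eq_weightedDirichlet`, cutoff removed, general weights):
  `∫ u k dμ_T = γ T (A_0 + A_m)`, i.e. `s − λ N = γ T (A_0 + A_m)` (`relocResolventDirichlet`).
* GAUSSIAN PROJECTION (landed `integral_mul_sq_sub_gibbsMeasure`) `s = T J` and EQUIPARTITION `∫ p_0² dμ_T = T`
  give the completed-square identity `γ (T² − γ s) = γ T (‖p_0 − γ ∂_{p_0} u‖² + γ² A_m) + γ² λ N`.
* Hence `γ s < T²` as soon as `N > 0`; and if `N = 0` then `u ≡ 0` (landed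
  `relocPositiveConductance_eq_zero_of_integral_sq`: continuous integrand, positive continuous density), so
  `s = 0` and `G[u] = γ > 0` trivially.

References: Eckmann–Pillet–Rey-Bellet 1999 §3 (entropy production of the open chain); Rey-Bellet 2003 Rem. 4.4
(finite-volume Kubo conductance); Kundu–Dhar–Narayan 2009 (relocated bath); folklore.
-/

noncomputable section

open MeasureTheory Filter Topology
open scoped ContDiff
open Literature.MathematicalPhysics.KineticTheory.HeatConduction
open Summit.AtomisticToContinuum.FouriersLaw.Theorems.SuperadditiveResistance.DeviceLiouville
  (kin kin_eq_sq thermo liouvilleOp bathOp)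
open Summit.AtomisticToContinuum.FouriersLaw.Theorems.SuperadditiveResistance.Kubo (memLp_partialP)
open Summit.AtomisticToContinuum.FouriersLaw.Cruxes.SuperadditiveResistance.FloatingProbeBypassLaplacian
  (pinnedChain_memLp_two_snd pinnedChain_integral_snd_sq integral_mul_sq_sub_gibbsMeasure
    pinnedChain_memLp_two_kin)

namespace Summit.AtomisticToContinuum.FouriersLaw.Cruxes.ConductanceLowerBound.ColdBathRelocationWalk

/-! ## The resolvent equation in weighted pair form -/

section ResolventPair

/-- The resolvent equation `λ u − (X_H u + γ(S_0 + S_m) u) = p_0² − T` in the weighted pair form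
`1·X_H u + γ S_{B_m} u = −((p_0² − T) − λ u)` used by the Kubo toolkit (`B_m i = [i=0] + [i=m]`). [folklore] -/
theorem relocResolvent_pair {ω₂ lam β γ T l : ℝ} {L m : ℕ} {u : PhaseSpace L → ℝ}
    (hres : ∀ x, l * u x - (liouvilleOp (pinnedChain ω₂ lam β γ) L u x +
      γ * (thermo L 0 T u x + thermo L m T u x)) = kin L 0 x - T) (x : PhaseSpace L) :
    1 * liouvilleOp (pinnedChain ω₂ lam β γ) L u x +
      γ * bathOp L (fun i : Fin L => (if i.val = 0 then (1 : ℝ) else 0) + (if i.val = m then 1 else 0)) T u x =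
      -(kin L 0 x - T - l * u x) := by
  rw [one_mul, ← relocDirichlet_thermo_add_thermo_eq_bathOp]
  linear_combination (-1 : ℝ) * hres x

end ResolventPair

/-! ## The resolvent Dirichlet identity and the registered stub R3λ -/

section Resolvent

/-- **Dirichlet identity of a resolvent field.** For all parameters `> 0`, `T > 0`, `m < L`, `λ > 0` and every
classical `C² ∩ L²(μ_T)` solution `u` of `λ u − (X_H u + γ(S_0 + S_m) u) = p_0² − T`:
`∂_{p_0} u, ∂_{p_m} u ∈ L²(μ_T)` and
`∫ u (p_0² − T) dμ_T − λ ∫ u² dμ_T = γ T (∫ (∂_{p_0} u)² dμ_T + ∫ (∂_{p_m} u)² dμ_T)`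
(the landed weighted carré du champ `integral_mul_source_eq_weightedDirichlet` with source `(p_0² − T) − λ u`;
for `m = 0` both Dirichlet terms are `‖∂_{p_0} u‖²`, weight `2`). [folklore] -/
theorem relocResolventDirichlet :
    ∀ (ω₂ lam β γ T : ℝ), 0 < ω₂ → 0 < lam → 0 < β → 0 < γ → 0 < T →
      ∀ (L m : ℕ) (hL : 0 < L) (hm : m < L) (l : ℝ) (u : PhaseSpace L → ℝ), ContDiff ℝ 2 u →
        MemLp u 2 ((pinnedChain ω₂ lam β γ).gibbsMeasure L T) →
        (∀ x, l * u x - (liouvilleOp (pinnedChain ω₂ lam β γ) L u x +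
          γ * (thermo L 0 T u x + thermo L m T u x)) = kin L 0 x - T) →
        MemLp (partialP ⟨0, hL⟩ u) 2 ((pinnedChain ω₂ lam β γ).gibbsMeasure L T) ∧
        MemLp (partialP ⟨m, hm⟩ u) 2 ((pinnedChain ω₂ lam β γ).gibbsMeasure L T) ∧
        (∫ x, u x * (kin L 0 x - T) ∂((pinnedChain ω₂ lam β γ).gibbsMeasure L T)) -
            l * ∫ x, u x ^ 2 ∂((pinnedChain ω₂ lam β γ).gibbsMeasure L T) =
          γ * T * ((∫ x, (partialP ⟨0, hL⟩ u x) ^ 2 ∂((pinnedChain ω₂ lam β γ).gibbsMeasure L T)) +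
            ∫ x, (partialP ⟨m, hm⟩ u x) ^ 2 ∂((pinnedChain ω₂ lam β γ).gibbsMeasure L T)) := by
  intro ω₂ lam β γ T hω hl hβ hγ hT L m hL hm l u huC hu2 hres
  set P := pinnedChain ω₂ lam β γ with hP
  haveI : IsProbabilityMeasure (P.gibbsMeasure L T) :=
    pinnedChain_isProbabilityMeasure_gibbsMeasure hω hl.le hβ.le γ L hT
  -- the source `k = (p_0² − T) − λ u` is in `L²(μ_T)`
  have hk0L2 : MemLp (fun x => kin L 0 x - T) 2 (P.gibbsMeasure L T) :=
    (pinnedChain_memLp_two_kin hω hl.le hβ.le γ L 0 hT).sub (memLp_const T)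
  have hkL2 : MemLp (fun x => kin L 0 x - T - l * u x) 2 (P.gibbsMeasure L T) := hk0L2.sub (hu2.const_mul l)
  have hpair := relocResolvent_pair hres
  -- finite entropy production at the two weighted sites
  have ha0L2 : MemLp (partialP ⟨0, hL⟩ u) 2 (P.gibbsMeasure L T) :=
    memLp_partialP hω hl.le hβ.le γ L hT _ (relocDirichlet_weight_nonneg L m) 1 hγ huC hu2 hkL2 hpair
      (relocDirichlet_weight_pos_zero hL m)
  have hamL2 : MemLp (partialP ⟨m, hm⟩ u) 2 (P.gibbsMeasure L T) :=
    memLp_partialP hω hl.le hβ.le γ L hT _ (relocDirichlet_weight_nonneg L m) 1 hγ huC hu2 hkL2 hpair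
      (relocDirichlet_weight_pos_site hm)
  refine ⟨ha0L2, hamL2, ?_⟩
  -- the weighted carré du champ with source `k`, in Gibbs-measure form
  have hD : ∫ x, u x * (kin L 0 x - T - l * u x) ∂(P.gibbsMeasure L T) =
      γ * T * ((∫ x, (partialP ⟨0, hL⟩ u x) ^ 2 ∂(P.gibbsMeasure L T)) +
        ∫ x, (partialP ⟨m, hm⟩ u x) ^ 2 ∂(P.gibbsMeasure L T)) := by
    have hDρ := integral_mul_source_eq_weightedDirichlet hω hl.le hβ.le hT _ (relocDirichlet_weight_nonneg L m)
      1 hγ huC hu2 hkL2 hpair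
    rw [relocDirichlet_sum_weight_mul hL hm (fun i => ∫ x, partialP i u x ^ 2 * P.gibbsDensity L T x)] at hDρ
    rw [P.integral_gibbsMeasure, P.integral_gibbsMeasure, P.integral_gibbsMeasure, hDρ]
    ring
  -- split the pairing: `∫ u k = s − λ N`
  have i1 : Integrable (fun x => u x * (kin L 0 x - T)) (P.gibbsMeasure L T) := hu2.integrable_mul hk0L2
  have iN : Integrable (fun x => u x ^ 2) (P.gibbsMeasure L T) := hu2.integrable_sq
  rw [← hD, ← integral_const_mul, ← integral_sub i1 (iN.const_mul l)]
  exact integral_congr_ae (ae_of_all _ fun x => by ring)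

/-- **R3λ — RESOLVENT RELOCATED CONDUCTANCES ARE POSITIVE (fixed `N`, size S).**  For `pinnedChain ω₂ lam β γ`
(all parameters `> 0`), `T > 0`, `m < L` (`m = 0` allowed), `λ > 0` and every classical `C² ∩ L²(μ_T)` solution `u`
of the resolvent equation `λ u − (X_H u + γ(S_0 + S_m) u) = p_0² − T`, the Kubo conductance functional
`γ (1 − (γ/T²) ∫ u (p_0² − T) dμ_T)` is STRICTLY positive.  Proof: with `s = ∫ u (p_0² − T)`, `N = ∫ u²`,
the resolvent Dirichlet identity `s − λN = γT(‖∂_{p_0} u‖² + ‖∂_{p_m} u‖²)` (`relocResolventDirichlet`), the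
Gaussian projection `s = T ∫ ∂_{p_0} u · p_0` and equipartition `∫ p_0² = T` give
`γ(T² − γ s) = γT(‖p_0 − γ∂_{p_0} u‖² + γ²‖∂_{p_m} u‖²) + γ²λN`; so `γ s < T²` if `N > 0`, while `N = 0` forces
`u ≡ 0` (`relocPositiveConductance_eq_zero_of_integral_sq`), `s = 0`, and the functional equals `γ > 0`. [folklore] -/
theorem stub_relocPositiveConductance_resolvent :
    ∀ (ω₂ lam β γ T : ℝ), 0 < ω₂ → 0 < lam → 0 < β → 0 < γ → 0 < T →
      ∀ (L m : ℕ), m < L → ∀ (l : ℝ), 0 < l → ∀ u : PhaseSpace L → ℝ, ContDiff ℝ 2 u →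
        MemLp u 2 ((pinnedChain ω₂ lam β γ).gibbsMeasure L T) →
        (∀ x, l * u x - (liouvilleOp (pinnedChain ω₂ lam β γ) L u x + γ * (thermo L 0 T u x + thermo L m T u x)) =
          kin L 0 x - T) →
        0 < γ * (1 - γ / T ^ 2 * ∫ x, u x * (kin L 0 x - T) ∂((pinnedChain ω₂ lam β γ).gibbsMeasure L T)) := by
  intro ω₂ lam β γ T hω hl hβ hγ hT L m hm l hl0 u huC hu2 hres
  have hL : 0 < L := lt_of_le_of_lt (Nat.zero_le m) hm
  set P := pinnedChain ω₂ lam β γ with hP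
  set μ := P.gibbsMeasure L T with hμ
  set i0 : Fin L := ⟨0, hL⟩ with hi0
  set im : Fin L := ⟨m, hm⟩ with him
  haveI : IsProbabilityMeasure μ := pinnedChain_isProbabilityMeasure_gibbsMeasure hω hl.le hβ.le γ L hT
  obtain ⟨ha0L2, -, hD⟩ := relocResolventDirichlet ω₂ lam β γ T hω hl hβ hγ hT L m hL hm l u huC hu2 hres
  have hud : Differentiable ℝ u := huC.differentiable two_ne_zero
  have hpL2 : MemLp (fun x : PhaseSpace L => x.2 i0) 2 μ := pinnedChain_memLp_two_snd hω hl.le hβ.le γ L hT i0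
  -- (P) Gaussian projection
  have hA : ∫ x, u x * (kin L 0 x - T) ∂μ = T * ∫ x, partialP i0 u x * x.2 i0 ∂μ := by
    rw [← integral_mul_sq_sub_gibbsMeasure hω hl.le hβ.le γ L hT i0 hud hu2 ha0L2]
    exact integral_congr_ae (ae_of_all _ fun x => by dsimp only; rw [kin_eq_sq hL])
  -- equipartition
  have hE : ∫ x, x.2 i0 ^ 2 ∂μ = T := pinnedChain_integral_snd_sq hω hl.le hβ.le γ L hT i0
  -- the completed square `‖p_0 − γ ∂_{p_0} u‖²`
  have ip : Integrable (fun x : PhaseSpace L => x.2 i0 ^ 2) μ := hpL2.integrable_sq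
  have i2 : Integrable (fun x => partialP i0 u x * x.2 i0) μ := ha0L2.integrable_mul hpL2
  have i3 : Integrable (fun x => partialP i0 u x ^ 2) μ := ha0L2.integrable_sq
  have hY : ∫ x, (x.2 i0 - γ * partialP i0 u x) ^ 2 ∂μ =
      (∫ x, x.2 i0 ^ 2 ∂μ) - 2 * γ * (∫ x, partialP i0 u x * x.2 i0 ∂μ) +
        γ ^ 2 * ∫ x, partialP i0 u x ^ 2 ∂μ := by
    have e1 : ∫ x, (x.2 i0 - γ * partialP i0 u x) ^ 2 ∂μ =
        ∫ x, (x.2 i0 ^ 2 - 2 * γ * (partialP i0 u x * x.2 i0) + γ ^ 2 * partialP i0 u x ^ 2) ∂μ :=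
      integral_congr_ae (ae_of_all _ fun x => by ring)
    have i12 : Integrable (fun x => x.2 i0 ^ 2 - 2 * γ * (partialP i0 u x * x.2 i0)) μ :=
      ip.sub (i2.const_mul _)
    rw [e1, integral_add i12 (i3.const_mul _), integral_sub ip (i2.const_mul _), integral_const_mul,
      integral_const_mul]
  have hY0 : 0 ≤ ∫ x, (x.2 i0 - γ * partialP i0 u x) ^ 2 ∂μ := integral_nonneg fun x => sq_nonneg _
  have hAm0 : 0 ≤ ∫ x, partialP im u x ^ 2 ∂μ := integral_nonneg fun x => sq_nonneg _
  have hN0 : 0 ≤ ∫ x, u x ^ 2 ∂μ := integral_nonneg fun x => sq_nonneg _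
  -- names
  set s := ∫ x, u x * (kin L 0 x - T) ∂μ with hs
  set N := ∫ x, u x ^ 2 ∂μ with hN
  set J := ∫ x, partialP i0 u x * x.2 i0 ∂μ with hJ
  set A0 := ∫ x, partialP i0 u x ^ 2 ∂μ with hA0
  set Am := ∫ x, partialP im u x ^ 2 ∂μ with hAm
  set Y := ∫ x, (x.2 i0 - γ * partialP i0 u x) ^ 2 ∂μ with hYdef
  set E := ∫ x, x.2 i0 ^ 2 ∂μ with hEdef
  -- the completed-square identity `γ (T² − γ s) = γ T (Y + γ² A_m) + γ² λ N`
  have hkey : γ * (T ^ 2 - γ * s) = γ * T * (Y + γ ^ 2 * Am) + γ ^ 2 * l * N := by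
    linear_combination (-2 * γ ^ 2) * hA + γ ^ 2 * hD + (-(γ * T)) * hY + (-(γ * T)) * hE
  rcases hN0.eq_or_lt with hN0' | hNpos
  · -- `N = 0`: `u ≡ 0`, so `s = 0` and the functional is `γ > 0`
    have hu0 : ∀ x, u x = 0 :=
      relocPositiveConductance_eq_zero_of_integral_sq hω hl.le hβ.le hT huC.continuous hu2 hN0'.symm
    have hs0 : s = 0 := by
      rw [hs]
      simp [hu0]
    rw [hs0, mul_zero, sub_zero, mul_one]
    exact hγ
  · -- `N > 0`: `γ s < T²`
    have hrhs : 0 < γ * T * (Y + γ ^ 2 * Am) + γ ^ 2 * l * N := by positivity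
    have h3 : 0 < γ * (T ^ 2 - γ * s) := by
      rw [hkey]
      exact hrhs
    have h2 : 0 < T ^ 2 - γ * s := (mul_pos_iff_of_pos_left hγ).mp h3
    have h4 : 1 - γ / T ^ 2 * s = (T ^ 2 - γ * s) / T ^ 2 := by
      field_simp
    rw [h4]
    exact mul_pos hγ (div_pos h2 (by positivity))

end Resolvent

end Summit.AtomisticToContinuum.FouriersLaw.Cruxes.ConductanceLowerBound.ColdBathRelocationWalk

end
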